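import Mathlib
import HarnessLib
import Summits.Langlands.Statement
import Summits.Langlands.Langlands.Theses.RootDecomp1
import Summits.Langlands.Langlands.Theorems.RootDecomp1SemisimpleAvatarOfSplit
import Literature.NumberTheory.GaloisRepresentations.HeckeDeterminant
import Literature.NumberTheory.GaloisRepresentations.StableLatticeValuationRing
import Literature.NumberTheory.GaloisRepresentations.ResidualRepresentation
import Literature.NumberTheory.GaloisRepresentations.AbsGaloisGroupCompact
import Literature.NumberTheory.GaloisRepresentations.FramedRepBaseChange
import Literature.NumberTheory.GaloisRepresentations.IntegralGaloisActionProofs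
import Literature.NumberTheory.Automorphic.ReciprocityGLn
import Literature.NumberTheory.Automorphic.AutomorphicRepsGLSatakeFlathProofs

/-!
# DetTower (PART A: items · vocabulary · dictionary) — lens-3-g16 node `DeterminantTowerSplit` (decomp-langlands, D-0171/D-0178)

Tree twin PART A of HOME/nodes/lens-3-g16-DeterminantTowerSplit.lean (§§1–3); PART B (`DetTowerAccessibleAvatarsKernel`, §4 kernels:
`depth_of_acc`, `int_of_acc`, `acc_of_pieces`, `acc_iff_pieces`, necessity certificates, `frame_of_host`, `closes`, `langlands_iff_pieces`) imports this file.

CHILD route of `Summit.Langlands.Langlands.Theses.RootDecomp1.AccessibleAvatars` (Acc, stmt-Langlands-29148,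
layer-2 child of E = `SemisimpleAvatar` 23598 in route-Langlands-RootDecomp1 rev 4).

THE ONE EQUIV (lens 3).  In the language of Chenevier determinants (`Literature…HeckeDeterminant`:
`GaloisDeterminant`, `HasFrobCharpolyAt`, `IsUnramifiedAt`) the accessible semisimple ℓ-adic avatar of a
cuspidal L-algebraic `π` on `GL_n/K`, `[K:K⁺] ≤ 2`, is EQUIVALENT to the conjunction of two statements of a
different kind:

* INT  `IntegralFrobeniusData`   — ARITHMETIC OF HECKE DATA: the Satake polynomials
  `arithFrobPolyOfSatake ι q_v 1 α_v` have, for almost all `v`, coefficients in ONE finite extension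
  `E/ℚ_ℓ` and in `𝒪 = 𝒪_{ℚ̄_ℓ}` (L-arithmeticity + ℓ-integrality; open for Maass `λ = 1/4`, print for
  regular `π` over every `K` by Clozel + integral cohomology);
* DEPTH `DeterminantTowerAvatars` — A Λ-ADIC DETERMINANT TOWER: one finite `S` and, for every `m ≥ 1`, a
  continuous (`IsLocallyConstant` characteristic polynomial) `𝒪/ℓ^m`-valued Galois determinant of
  dimension `n`, unramified outside `S`, whose Frobenius characteristic polynomials are the Satake
  polynomials mod `ℓ^m` (the language in which torsion / coherent-cohomology congruence engines act);

certified here by `acc_iff_pieces (hTR) (hQl) : Acc ↔ INT ∧ DEPTH`, where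
* TR `TowerRealisation` (support, PRINT) is the Taylor 1991 / Chenevier 2014 realisation of such a tower
  by a continuous semisimple `ρ : Γ_K → GL_n(ℚ̄_ℓ)` (Chenevier, in Diamond–Kassaei–Kim (eds.) 2014 =
  doi:10.1017/cbo9781107446335: Thm 7.34 (= Thm A) realisation with `ker ρ = ker D`, Cor. 7.11 descent,
  Ex. 7.50 density, Ex. 7.51 glueing over compact `A = 𝒪_E`, §2.5/Lemma 7.52 continuity; Amitsur (7.5)
  for the factorisation through `G_{K,S}`; Chebotarev; Taylor, Duke Math. J. 63 (1991) Thm 1 continuity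
  [Hida 2000, Thm 2.18 (1),(3)]), and
* `hQl = Literature.NumberTheory.Automorphic.exists_hasQlModel` (named fact, Buzzard–Gee 2014 fn. to
  Conj. 3.2.1, Baire) is used only in the necessity direction `int_of_acc`.

KERNEL (all proved below, 0 sorry): `tower_of_framedRep` (ρ ↦ its tower: integral model over the
valuation ring `𝒪` [`exists_integralModel_of_valuationSubring`, PROVED in the tree], reduction mod `ℓ^m`,
`GroupDeterminant.ofMonoidHom`, open kernel ⇒ locally constant), `depth_of_acc`, `int_of_acc`,
`acc_of_pieces` (S* = S_DEPTH ∪ exceptional set of INT, integral lifts `Polynomial.toSubring`, TR),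
`acc_iff_pieces`, the necessity certificates `acc_of_langlands`, `int_of_langlands (hQl)`,
`depth_of_langlands`, `frame_of_langlands`, the host certificate `frame_of_host` (FRAME from the other
fifteen items of RootDecomp1 via `RootDecomp1.closes` and `SemisimpleAvatar_of_split_proof`), the deciding
theorem `closes : INT → DEPTH → TR → FRAME → Langlands` and the exactness statement `langlands_iff_pieces`.

The four item texts in §1 are byte-identical with the route kit (`childroute.route.json`) and elaborate in
the gate's render context (`childroute.mock.lean`).  Node namespace `…Theorems.DetTower`; route namespace
`…Theses.DeterminantTowerSplit` (no clash).
-/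

set_option linter.unusedVariables false
set_option linter.dupNamespace false -- project-wide option; `Summit.Langlands.Langlands` is the mandated namespace

namespace Summit.Langlands.Langlands.Theorems.DetTower

open Literature.NumberTheory.GaloisRepresentations Literature.NumberTheory.Automorphic
open IsDedekindDomain
open Summit.Langlands.Langlands.Theses
open scoped NumberField Polynomial

/-! ## §1 The items (texts = route texts) -/

/-- INT (crux, rank 2): E-rationality and ℓ-integrality of the Frobenius (Satake) data. -/
def IntegralFrobeniusData : Prop :=
  ∀ (K : Type) [Field K] [NumberField K] (n : ℕ) (hcpt : Literature.NumberTheory.Automorphic.isCompact_glFiniteIntegralLevel n K), 0 < n → Module.finrank (NumberField.maximalRealSubfield K) K ≤ 2 → ∀ (π : Literature.NumberTheory.Automorphic.CuspidalAutomorphicRepData n K hcpt), π.1.IsLAlgebraic → ∀ (ℓ : ℕ) [Fact ℓ.Prime] (ι : PadicAlgCl ℓ ≃+* ℂ), ∃ E : IntermediateField ℚ_[ℓ] (PadicAlgCl ℓ), FiniteDimensional ℚ_[ℓ] E ∧ ∀ᶠ v : IsDedekindDomain.HeightOneSpectrum (NumberField.RingOfIntegers K) in Filter.cofinite, ∃ α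 : Multiset ℂ, π.1.HasSatakeParamAt v α ∧ ∀ i : ℕ, (Literature.NumberTheory.Automorphic.arithFrobPolyOfSatake ι v.residueCard 1 α).coeff i ∈ E ∧ (Literature.NumberTheory.Automorphic.arithFrobPolyOfSatake ι v.residueCard 1 α).coeff i ∈ (Valued.v : Valuation (PadicAlgCl ℓ) NNReal).valuationSubring

/-- DEPTH (crux, rank 3, declared residual): the Λ-adic determinant tower. -/
def DeterminantTowerAvatars : Prop :=
  ∀ (K : Type) [Field K] [NumberField K] (n : ℕ) (hcpt : Literature.NumberTheory.Automorphic.isCompact_glFiniteIntegralLevel n K), 0 < n → Module.finrank (NumberField.maximalRealSubfield K) K ≤ 2 → ∀ (π : Literature.NumberTheory.Automorphic.CuspidalAutomorphicRepData n K hcpt), π.1.IsLAlgebraic → ∀ (ℓ : ℕ) [Fact ℓ.Prime] (ι : PadicAlgCl ℓ ≃+* ℂ), ∃ S : Finset (IsDedekindDomain.HeightOneSpectrum (NumberField.RingOfIntegers K)), ∀ m : ℕ, 0 < m → ∃ D : Literature.NumberTheory.GaloisRepresentations.GaloisDeterminant K (↥(Valued.v : Valuation (PadicAlgCl ℓ)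 NNReal).valuationSubring ⧸ Ideal.span {((ℓ ^ m : ℕ) : ↥(Valued.v : Valuation (PadicAlgCl ℓ) NNReal).valuationSubring)}) n, IsLocallyConstant (fun g : Field.absoluteGaloisGroup K => D.charpoly (MonoidAlgebra.of _ _ g)) ∧ ∀ v ∉ S, D.IsUnramifiedAt v ∧ ∀ α : Multiset ℂ, π.1.HasSatakeParamAt v α → ∀ P : Polynomial ↥(Valued.v : Valuation (PadicAlgCl ℓ) NNReal).valuationSubring, P.map (Valued.v : Valuation (PadicAlgCl ℓ) NNReal).valuationSubring.subtype = Literature.NumberTheory.Automorphic.arithFrobPolyOfSatake ι v.residueCard 1 α → D.HasFrobCharpolyAt v (P.map (Ideal.Quotient.mk (Ideal.span {((ℓ ^ m : ℕ) : ↥(Valued.v : Valuation (PadicAlgCl ℓ) NNReal).valuationSubring)})))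

/-- TR (support, PRINT): Taylor 1991 / Chenevier 2014 realisation of a determinant tower. -/
def TowerRealisation : Prop :=
  ∀ (K : Type) [Field K] [NumberField K] (n : ℕ), 0 < n → ∀ (ℓ : ℕ) [Fact ℓ.Prime] (E : IntermediateField ℚ_[ℓ] (PadicAlgCl ℓ)), FiniteDimensional ℚ_[ℓ] E → ∀ (S : Finset (IsDedekindDomain.HeightOneSpectrum (NumberField.RingOfIntegers K))) (P : IsDedekindDomain.HeightOneSpectrum (NumberField.RingOfIntegers K) → Polynomial ↥(Valued.v : Valuation (PadicAlgCl ℓ) NNReal).valuationSubring), (∀ v ∉ S, ∀ i : ℕ, ((P v).coeff i : PadicAlgCl ℓ) ∈ E) → (∀ m : ℕ, 0 < m → ∃ D : Literature.NumberTheory.GaloisRepresentations.GaloisDeterminant K (↥(Valued.v : Valuation (PadicAlgCl ℓ) NNReal).valuationSubring ⧸ Ideal.span {((ℓ ^ m : ℕ) : ↥(Valued.v : Valuation (PadicAlgCl ℓ) NNReal).valuationSubring)}) n, IsLocallyConstant (fun g : Field.absoluteGaloisGroup K => D.charpoly (MonoidAlgebra.of _ _ g)) ∧ ∀ v ∉ S,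 D.IsUnramifiedAt v ∧ D.HasFrobCharpolyAt v ((P v).map (Ideal.Quotient.mk (Ideal.span {((ℓ ^ m : ℕ) : ↥(Valued.v : Valuation (PadicAlgCl ℓ) NNReal).valuationSubring)})))) → ∃ ρ : Literature.NumberTheory.GaloisRepresentations.FramedGaloisRep K (PadicAlgCl ℓ) n, ρ.toGaloisRep.IsSemisimple ∧ ∀ v ∉ S, ρ.IsUnramifiedAt v ∧ ρ.HasFrobCharpolyAt v ((P v).map (Valued.v : Valuation (PadicAlgCl ℓ) NNReal).valuationSubring.subtype)

/-- FRAME (support): Acc ⟹ Langlands given the rest of RootDecomp1 (`frame_of_host`). -/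
def DeterminantTowerFrame : Prop :=
  Summit.Langlands.Langlands.Theses.RootDecomp1.AccessibleAvatars → _root_.Langlands

/-- Assembly: the curried form of `closes`. -/
def Assembly : Prop :=
  IntegralFrobeniusData → DeterminantTowerAvatars → TowerRealisation → DeterminantTowerFrame → _root_.Langlands

/-! ## §2 Vocabulary: `𝒪 = 𝒪_{ℚ̄_ℓ}`, `Λ_m = 𝒪/ℓ^m` -/

section Vocabulary

/-- `𝒪 = 𝒪_{ℚ̄_ℓ}`, the valuation ring of `PadicAlgCl ℓ` (= `padicAlgClIntegers ℓ`). -/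
noncomputable abbrev Oint (ℓ : ℕ) [Fact ℓ.Prime] : ValuationSubring (PadicAlgCl ℓ) :=
  (Valued.v : Valuation (PadicAlgCl ℓ) NNReal).valuationSubring

/-- `Λ_m = 𝒪/ℓ^m`. -/
abbrev Lam (ℓ : ℕ) [Fact ℓ.Prime] (m : ℕ) : Type :=
  ↥(Oint ℓ) ⧸ Ideal.span {((ℓ ^ m : ℕ) : ↥(Oint ℓ))}

/-- the reduction map `𝒪 → Λ_m`. -/
noncomputable abbrev lamMk (ℓ : ℕ) [Fact ℓ.Prime] (m : ℕ) : ↥(Oint ℓ) →+* Lam ℓ m :=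
  Ideal.Quotient.mk (Ideal.span {((ℓ ^ m : ℕ) : ↥(Oint ℓ))})

end Vocabulary

/-! ## §3 Dictionary lemmas -/

section Dictionary

variable {K : Type} [Field K] {n : ℕ} {ℓ : ℕ} [Fact ℓ.Prime]

/-- In the valuation ring, `c ∣ y ↔ v(y) ≤ v(c)` (for `c ≠ 0`). [folklore] -/
theorem dvd_iff_v_le {c y : ↥(Oint ℓ)} (hc : (c : PadicAlgCl ℓ) ≠ 0) :
    c ∣ y ↔ Valued.v (y : PadicAlgCl ℓ) ≤ Valued.v (c : PadicAlgCl ℓ) := by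
  constructor
  · rintro ⟨d, rfl⟩
    have hd : Valued.v (d : PadicAlgCl ℓ) ≤ 1 := (Valuation.mem_valuationSubring_iff _ _).1 d.2
    have hcd : ((c * d : ↥(Oint ℓ)) : PadicAlgCl ℓ) = (c : PadicAlgCl ℓ) * (d : PadicAlgCl ℓ) := rfl
    rw [hcd, map_mul]
    exact mul_le_of_le_one_right (by simp) hd
  · intro h
    have hvc : (Valued.v (c : PadicAlgCl ℓ) : NNReal) ≠ 0 := (Valuation.ne_zero_iff _).2 hc
    have hmem : (y : PadicAlgCl ℓ) / (c : PadicAlgCl ℓ) ∈ Oint ℓ := by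
      rw [Valuation.mem_valuationSubring_iff, map_div₀]
      exact div_le_one_of_le₀ h (by simp)
    refine ⟨⟨(y : PadicAlgCl ℓ) / (c : PadicAlgCl ℓ), hmem⟩, Subtype.ext ?_⟩
    show (y : PadicAlgCl ℓ) = (c : PadicAlgCl ℓ) * ((y : PadicAlgCl ℓ) / (c : PadicAlgCl ℓ))
    rw [mul_div_cancel₀ _ hc]

/-- The closed ball `{x | v(x) ≤ v(c)}` (`c ≠ 0`) is open: it is `c • 𝒪`. [folklore] -/
theorem isOpen_setOf_v_le {c : PadicAlgCl ℓ} (hc : c ≠ 0) :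
    IsOpen {x : PadicAlgCl ℓ | Valued.v x ≤ Valued.v c} := by
  have hvc : (Valued.v c : NNReal) ≠ 0 := (Valuation.ne_zero_iff _).2 hc
  have hset : {x : PadicAlgCl ℓ | Valued.v x ≤ Valued.v c} =
      (fun x => c⁻¹ * x) ⁻¹' ((Oint ℓ : ValuationSubring (PadicAlgCl ℓ)) : Set (PadicAlgCl ℓ)) := by
    ext x
    simp only [Set.mem_setOf_eq, Set.mem_preimage, SetLike.mem_coe,
      Valuation.mem_valuationSubring_iff, map_mul, map_inv₀]
    rw [inv_mul_le_iff₀ (pos_iff_ne_zero.2 hvc), mul_one]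
  rw [hset]
  exact (Valued.isOpen_valuationSubring (PadicAlgCl ℓ)).preimage (continuous_const.mul continuous_id)

/-- `ℓ^m ≠ 0` in `ℚ̄_ℓ`. -/
theorem natCast_pow_ne_zero (m : ℕ) : ((ℓ ^ m : ℕ) : PadicAlgCl ℓ) ≠ 0 := by
  haveI : CharZero (PadicAlgCl ℓ) := charZero_of_injective_algebraMap (algebraMap ℚ_[ℓ] _).injective
  exact Nat.cast_ne_zero.2 (pow_ne_zero _ (Fact.out : ℓ.Prime).ne_zero)

/-- **The reduction mod `ℓ^m` of an integral model has open kernel** (the `ℓ^m`-analogue of the tree's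
`isOpen_ker_residualRep`, Deligne–Serre 6.12): with `ρ₀(g) = P⁻¹ ρ(g) P ∈ GL_n(𝒪)`, the kernel of
`ρ₀ mod ℓ^m : Γ_K → GL_n(𝒪/ℓ^m)` is open. [folklore] -/
theorem isOpen_ker_reduction {ρ : FramedGaloisRep K (PadicAlgCl ℓ) n} {Pm : GL (Fin n) (PadicAlgCl ℓ)}
    {ρ₀ : Field.absoluteGaloisGroup K →* GL (Fin n) ↥(Oint ℓ)}
    (h : ∀ g, Matrix.GeneralLinearGroup.map (Oint ℓ).subtype (ρ₀ g) = Pm⁻¹ * ρ g * Pm) (m : ℕ) :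
    IsOpen (((Matrix.GeneralLinearGroup.map (lamMk ℓ m)).comp ρ₀).ker :
      Set (Field.absoluteGaloisGroup K)) := by
  let c : ↥(Oint ℓ) := ((ℓ ^ m : ℕ) : ↥(Oint ℓ))
  have hcF : (c : PadicAlgCl ℓ) = ((ℓ ^ m : ℕ) : PadicAlgCl ℓ) := by simp [c]
  have hc : (c : PadicAlgCl ℓ) ≠ 0 := by rw [hcF]; exact natCast_pow_ne_zero m
  -- the entries of `ρ₀ g - 1`
  let y : Field.absoluteGaloisGroup K → Fin n → Fin n → ↥(Oint ℓ) := fun g i j =>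
    ((ρ₀ g : GL (Fin n) ↥(Oint ℓ)) : Matrix (Fin n) (Fin n) ↥(Oint ℓ)) i j -
      (1 : Matrix (Fin n) (Fin n) ↥(Oint ℓ)) i j
  have hmap : ∀ (g : Field.absoluteGaloisGroup K) (i j : Fin n),
      ((Matrix.GeneralLinearGroup.map (lamMk ℓ m) (ρ₀ g) : GL (Fin n) (Lam ℓ m)) :
        Matrix (Fin n) (Fin n) (Lam ℓ m)) i j =
          lamMk ℓ m (((ρ₀ g : GL (Fin n) ↥(Oint ℓ)) : Matrix (Fin n) (Fin n) ↥(Oint ℓ)) i j) :=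
    fun _ _ _ => rfl
  have hone : ∀ i j : Fin n, lamMk ℓ m ((1 : Matrix (Fin n) (Fin n) ↥(Oint ℓ)) i j) =
      (1 : Matrix (Fin n) (Fin n) (Lam ℓ m)) i j := fun i j => by
    by_cases hij : i = j
    · subst hij; simp
    · simp [Matrix.one_apply_ne hij]
  have hker : (((Matrix.GeneralLinearGroup.map (lamMk ℓ m)).comp ρ₀).ker :
      Set (Field.absoluteGaloisGroup K)) = ⋂ i, ⋂ j, {g | c ∣ y g i j} := by
    ext g
    simp only [SetLike.mem_coe, MonoidHom.mem_ker, MonoidHom.comp_apply, Set.mem_iInter,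
      Set.mem_setOf_eq]
    constructor
    · intro hg i j
      have hij : ((Matrix.GeneralLinearGroup.map (lamMk ℓ m) (ρ₀ g) : GL (Fin n) (Lam ℓ m)) :
          Matrix (Fin n) (Fin n) (Lam ℓ m)) i j = ((1 : GL (Fin n) (Lam ℓ m)) : Matrix (Fin n) (Fin n) (Lam ℓ m)) i j :=
        congrArg (fun M : GL (Fin n) (Lam ℓ m) => (M : Matrix (Fin n) (Fin n) (Lam ℓ m)) i j) hg
      rw [hmap, Units.val_one, ← hone] at hij
      exact Ideal.mem_span_singleton.1 (Ideal.Quotient.eq.1 hij)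
    · intro hg
      refine Units.ext (Matrix.ext fun i j => ?_)
      rw [hmap, Units.val_one, ← hone]
      exact Ideal.Quotient.eq.2 (Ideal.mem_span_singleton.2 (hg i j))
  rw [hker]
  refine isOpen_iInter_of_finite fun i => isOpen_iInter_of_finite fun j => ?_
  have hset : {g | c ∣ y g i j} =
      (fun g : Field.absoluteGaloisGroup K =>
        ((Pm⁻¹ * ρ g * Pm : GL (Fin n) (PadicAlgCl ℓ)) : Matrix (Fin n) (Fin n) (PadicAlgCl ℓ)) i j -
          (1 : Matrix (Fin n) (Fin n) (PadicAlgCl ℓ)) i j) ⁻¹'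
        {x : PadicAlgCl ℓ | Valued.v x ≤ Valued.v (c : PadicAlgCl ℓ)} := by
    ext g
    have hval : ((Pm⁻¹ * ρ g * Pm : GL (Fin n) (PadicAlgCl ℓ)) :
        Matrix (Fin n) (Fin n) (PadicAlgCl ℓ)) i j - (1 : Matrix (Fin n) (Fin n) (PadicAlgCl ℓ)) i j =
          (y g i j : PadicAlgCl ℓ) := by
      rw [← h g]
      by_cases hij' : i = j
      · subst hij'
        simp [y, Matrix.GeneralLinearGroup.map]
      · simp [y, Matrix.GeneralLinearGroup.map, Matrix.one_apply_ne hij']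
    simp only [Set.mem_setOf_eq, Set.mem_preimage, hval]
    exact dvd_iff_v_le hc
  rw [hset]
  refine (isOpen_setOf_v_le hc).preimage ?_
  have hcont : Continuous fun g : Field.absoluteGaloisGroup K =>
      ((Pm⁻¹ * ρ g * Pm : GL (Fin n) (PadicAlgCl ℓ)) : Matrix (Fin n) (Fin n) (PadicAlgCl ℓ)) :=
    Units.continuous_val.comp ((continuous_const.mul (map_continuous ρ)).mul continuous_const)
  exact (hcont.matrix_elem i j).sub continuous_const

/-- A group homomorphism with open kernel out of a topological group is locally constant. [folklore] -/
theorem isLocallyConstant_of_isOpen_ker {G H : Type*} [Group G] [TopologicalSpace G] [ContinuousMul G]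
    [Group H] (f : G →* H) (hf : IsOpen (f.ker : Set G)) : IsLocallyConstant f := by
  refine (IsLocallyConstant.iff_exists_open f).2 fun g₀ =>
    ⟨(fun g => g₀⁻¹ * g) ⁻¹' (f.ker : Set G), hf.preimage (continuous_const.mul continuous_id),
      by simp, fun g hg => ?_⟩
  simp only [Set.mem_preimage, SetLike.mem_coe, MonoidHom.mem_ker, map_mul, map_inv,
    inv_mul_eq_one] at hg
  exact hg.symm

/-- An integral model sees `ρ σ = 1` (injectivity of `GL_n(𝒪) → GL_n(ℚ̄_ℓ)`). [folklore] -/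
theorem integralModel_eq_one {ρ : FramedGaloisRep K (PadicAlgCl ℓ) n} {Pm : GL (Fin n) (PadicAlgCl ℓ)}
    {ρ₀ : Field.absoluteGaloisGroup K →* GL (Fin n) ↥(Oint ℓ)}
    (h : ∀ g, Matrix.GeneralLinearGroup.map (Oint ℓ).subtype (ρ₀ g) = Pm⁻¹ * ρ g * Pm)
    {σ : Field.absoluteGaloisGroup K} (hσ : ρ σ = 1) : ρ₀ σ = 1 := by
  have h1 : Matrix.GeneralLinearGroup.map (Oint ℓ).subtype (ρ₀ σ) = 1 := by
    rw [h σ, hσ, mul_one, inv_mul_cancel]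
  have h2 := congrArg (fun M : GL (Fin n) (PadicAlgCl ℓ) => (M : Matrix (Fin n) (Fin n) (PadicAlgCl ℓ))) h1
  simp only [Units.val_one] at h2
  apply Units.ext
  apply Matrix.map_injective (f := fun x : ↥(Oint ℓ) => (x : PadicAlgCl ℓ)) Subtype.val_injective
  simp only [Units.val_one]
  rw [Matrix.map_one (fun x : ↥(Oint ℓ) => (x : PadicAlgCl ℓ)) rfl rfl]
  exact h2

/-- An integral model has the characteristic polynomials of `ρ` (framed copy of the tree's
`charpoly_integralModel`). [folklore] -/
theorem charpoly_integralModel_framed {ρ : FramedGaloisRep K (PadicAlgCl ℓ) n}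
    {Pm : GL (Fin n) (PadicAlgCl ℓ)} {ρ₀ : Field.absoluteGaloisGroup K →* GL (Fin n) ↥(Oint ℓ)}
    (h : ∀ g, Matrix.GeneralLinearGroup.map (Oint ℓ).subtype (ρ₀ g) = Pm⁻¹ * ρ g * Pm)
    (g : Field.absoluteGaloisGroup K) :
    (((ρ₀ g : GL (Fin n) ↥(Oint ℓ)) : Matrix (Fin n) (Fin n) ↥(Oint ℓ)).charpoly).map (Oint ℓ).subtype =
      FramedRep.charpoly ρ g := by
  unfold FramedRep.charpoly
  rw [← Matrix.charpoly_map]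
  have h1 : ((ρ₀ g : GL (Fin n) ↥(Oint ℓ)) : Matrix (Fin n) (Fin n) ↥(Oint ℓ)).map (Oint ℓ).subtype =
      ((Matrix.GeneralLinearGroup.map (Oint ℓ).subtype (ρ₀ g) : GL (Fin n) (PadicAlgCl ℓ)) :
        Matrix (Fin n) (Fin n) (PadicAlgCl ℓ)) := rfl
  rw [h1, h, Units.val_mul, Units.val_mul, Matrix.coe_units_inv]
  exact Matrix.charpoly_units_conj' Pm _

/-- Change of frame does not change characteristic polynomials. [folklore] -/
theorem charpoly_conj_eq {A : Type*} [CommRing A] [TopologicalSpace A] [IsTopologicalRing A]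
    (P : GL (Fin n) A) (r : FramedGaloisRep K A n) (g : Field.absoluteGaloisGroup K) :
    FramedRep.charpoly (FramedRep.conj P r) g = FramedRep.charpoly r g := by
  simp only [FramedRep.charpoly, FramedRep.conj_apply, Units.val_mul, Matrix.coe_units_inv]
  exact Matrix.charpoly_units_conj P _

/-- A model over `E` makes all characteristic polynomials `E`-rational. [folklore] -/
theorem coeff_charpoly_mem_of_hasQlModel {r : FramedGaloisRep K (PadicAlgCl ℓ) n}
    {E : IntermediateField ℚ_[ℓ] (PadicAlgCl ℓ)} {rE : FramedGaloisRep K E n}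
    (h : HasQlModel r E rE) (g : Field.absoluteGaloisGroup K) (i : ℕ) :
    (FramedRep.charpoly r g).coeff i ∈ E := by
  obtain ⟨P, rfl⟩ := h
  rw [charpoly_conj_eq, FramedRep.charpoly_baseChange, Polynomial.coeff_map,
    IntermediateField.algebraMap_apply]
  exact SetLike.coe_mem _

/-- Characteristic polynomials of a continuous `ρ : Γ_K → GL_n(ℚ̄_ℓ)` are `ℓ`-adically integral
(an integral model over the valuation ring exists: `exists_integralModel_of_valuationSubring`, PROVED in
the tree). [folklore] -/
theorem coeff_charpoly_mem_integers (ρ : FramedGaloisRep K (PadicAlgCl ℓ) n)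
    (g : Field.absoluteGaloisGroup K) (i : ℕ) : (FramedRep.charpoly ρ g).coeff i ∈ Oint ℓ := by
  haveI : CompactSpace (Field.absoluteGaloisGroup K) := absoluteGaloisGroup_compactSpace K
  obtain ⟨Pm, ρ₀, h⟩ := exists_integralModel_of_valuationSubring (O := Oint ℓ)
    (Valued.isOpen_valuationSubring (PadicAlgCl ℓ)) ρ
  rw [← charpoly_integralModel_framed h g, Polynomial.coeff_map]
  exact SetLike.coe_mem _

/-- **K1 — the dictionary `ρ ↦ its Λ-adic tower`.**  A continuous `ρ : Γ_K → GL_n(ℚ̄_ℓ)` unramified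
outside `S` with Frobenius characteristic polynomials `Q v` (`v ∉ S`) yields, for every `m`, a locally
constant `𝒪/ℓ^m`-valued Galois determinant of dimension `n` unramified outside `S` whose Frobenius
characteristic polynomials are the reductions of any integral lift of `Q v`:  integral model `ρ₀` over
`𝒪 = 𝒪_{ℚ̄_ℓ}` (`exists_integralModel_of_valuationSubring`), `D_m = det ∘ (ρ₀ mod ℓ^m)`
(`GroupDeterminant.ofMonoidHom`), open kernel (`isOpen_ker_reduction`). [folklore] -/
theorem tower_of_framedRep (ρ : FramedGaloisRep K (PadicAlgCl ℓ) n)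
    (S : Finset (HeightOneSpectrum (𝓞 K))) (Q : HeightOneSpectrum (𝓞 K) → (PadicAlgCl ℓ)[X])
    (hS : ∀ v ∉ S, ρ.IsUnramifiedAt v ∧ ρ.HasFrobCharpolyAt v (Q v)) (m : ℕ) :
    ∃ D : GaloisDeterminant K (Lam ℓ m) n,
      IsLocallyConstant (fun g : Field.absoluteGaloisGroup K => D.charpoly (MonoidAlgebra.of _ _ g)) ∧
      ∀ v ∉ S, D.IsUnramifiedAt v ∧ ∀ P : Polynomial ↥(Oint ℓ), P.map (Oint ℓ).subtype = Q v →
        D.HasFrobCharpolyAt v (P.map (lamMk ℓ m)) := by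
  haveI : CompactSpace (Field.absoluteGaloisGroup K) := absoluteGaloisGroup_compactSpace K
  obtain ⟨Pm, ρ₀, hρ₀⟩ := exists_integralModel_of_valuationSubring (O := Oint ℓ)
    (Valued.isOpen_valuationSubring (PadicAlgCl ℓ)) ρ
  let ρm : Field.absoluteGaloisGroup K →* GL (Fin n) (Lam ℓ m) :=
    (Matrix.GeneralLinearGroup.map (lamMk ℓ m)).comp ρ₀
  let ρm' : Field.absoluteGaloisGroup K →* Matrix (Fin n) (Fin n) (Lam ℓ m) :=
    (Units.coeHom (Matrix (Fin n) (Fin n) (Lam ℓ m))).comp ρm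
  have hρm' : ∀ g, ρm' g = ((ρm g : GL (Fin n) (Lam ℓ m)) : Matrix (Fin n) (Fin n) (Lam ℓ m)) :=
    fun _ => rfl
  refine ⟨GroupDeterminant.ofMonoidHom ρm', ?_, fun v hv => ⟨?_, ?_⟩⟩
  · -- local constancy: the kernel of `ρ₀ mod ℓ^m` is open
    have hlc : IsLocallyConstant (ρm : Field.absoluteGaloisGroup K → GL (Fin n) (Lam ℓ m)) :=
      isLocallyConstant_of_isOpen_ker ρm (isOpen_ker_reduction hρ₀ m)
    have heq : (fun g : Field.absoluteGaloisGroup K =>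
        (GroupDeterminant.ofMonoidHom ρm').charpoly (MonoidAlgebra.of _ _ g)) =
        (fun M : GL (Fin n) (Lam ℓ m) => (M : Matrix (Fin n) (Fin n) (Lam ℓ m)).charpoly) ∘ ρm := by
      funext g
      rw [Function.comp_apply, GroupDeterminant.charpoly_ofMonoidHom_of, hρm']
    rw [heq]
    exact hlc.comp _
  · -- unramified outside `S`
    intro 𝔓 h𝔓 σ hσ g
    have h1 : ρ σ = 1 := (hS v hv).1 𝔓 h𝔓 σ hσ
    have h2 : ρ₀ σ = 1 := integralModel_eq_one hρ₀ h1
    have h3 : ρm' σ = 1 := by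
      rw [hρm']
      simp [ρm, h2]
    rw [GroupDeterminant.revCharpoly_ofMonoidHom_of, GroupDeterminant.revCharpoly_ofMonoidHom_of,
      map_mul, h3, mul_one]
  · -- Frobenius characteristic polynomials
    intro P hP 𝔓 h𝔓 σ hσ
    have hQ : FramedRep.charpoly ρ σ = Q v := (hS v hv).2 𝔓 h𝔓 σ hσ
    have hint : ((ρ₀ σ : GL (Fin n) ↥(Oint ℓ)) : Matrix (Fin n) (Fin n) ↥(Oint ℓ)).charpoly = P := by
      apply Polynomial.map_injective (Oint ℓ).subtype Subtype.val_injective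
      rw [hP, ← hQ]
      exact charpoly_integralModel_framed hρ₀ σ
    rw [GroupDeterminant.charpoly_ofMonoidHom_of, hρm', ← hint, ← Matrix.charpoly_map]
    rfl

/-- An irreducible continuous Galois representation over a field is semisimple. [folklore] -/
theorem isSemisimple_of_isIrreducible {A : Type*} [Field A] [TopologicalSpace A] [IsTopologicalRing A]
    (ρ : FramedGaloisRep K A n) (h : ρ.toGaloisRep.IsIrreducible) : ρ.toGaloisRep.IsSemisimple := by
  haveI : ρ.toGaloisRep.toRepresentation.IsIrreducible := h
  change ComplementedLattice _
  infer_instance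

/-- `∀ i, p.coeff i ∈ T` gives the hypothesis of `Polynomial.toSubring`. [folklore] -/
theorem coeffs_subset_of_forall_coeff_mem {R : Type*} [Ring R] {p : R[X]} {T : Subring R}
    (h : ∀ i, p.coeff i ∈ T) : (↑p.coeffs : Set R) ⊆ T := by
  intro a ha
  obtain ⟨i, -, rfl⟩ := Polynomial.mem_coeffs_iff.1 (Finset.mem_coe.1 ha)
  exact h i

end Dictionary

end Summit.Langlands.Langlands.Theorems.DetTower
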